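import Literature.NumberTheory.LFunctions.AbelianFieldDedekindZeta
import HarnessLib

/-!
# The Euler-factor identity for the character group of a finite abelian group

Topic `Literature/NumberTheory/LFunctions`; namespace `Literature.NumberTheory.LFunctions.CharacterGroup`.
Pure-proof file (theorems only).  The tree's `AbelianDedekindZeta.prod_filter_one_sub_apply_mul`
(`AbelianFieldDedekindZeta.lean`) is the identity below for DIRICHLET characters mod `m` (characters of
`(ℤ/m)ˣ`); here it is proved for the characters `χ : G →* ℂˣ` of an ARBITRARY finite abelian group `G`
(Mathlib's duality `CommGroup.subgroupOrderIsoSubgroupMonoidHom`), which is the form needed to factor the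
Dedekind zeta function of an abelian extension `N/E` of NUMBER FIELDS over the characters of `Gal(N/E)`
(`ζ_N = ∏_χ L(s, χ ∘ Frob)` prime by prime: for `𝔭` unramified with Frobenius `σ_𝔭` of order `f`,
`∏_χ (1 − χ(σ_𝔭) N𝔭^{-s}) = (1 − N𝔭^{-fs})^{[N:E]/f} = ∏_{𝔓 ∣ 𝔭} (1 − N𝔓^{-s})`).

* `card_filter_monoidHom_trivialOn` — `#{χ : G →* ℂˣ | χ|_B = 1} = [G : B]`;
* `prod_filter_monoidHom_one_sub_apply_mul` — for a subgroup `B ≤ G`, `u ∈ G` whose class in `G/B` has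
  order `f`, and `T : ℂ`:  `∏_{χ|_B = 1} (1 − χ(u) T) = (1 − T^f)^{[G : B⟨u⟩]}`;
* `prod_monoidHom_one_sub_apply_mul` — `B = 1`: `∏_{χ ∈ Ĝ} (1 − χ(u) T) = (1 − T^{ord u})^{[G : ⟨u⟩]}`.

(The `Fintype (G →* ℂˣ)` instance is an argument; supply `Fintype.ofFinite _`.)

## References

* L. C. Washington, *Introduction to Cyclotomic Fields*, 2nd ed., Springer 1997, proof of Thm. 4.3.
  [Washington1997]
* J. Neukirch, *Algebraic Number Theory*, Springer 1999, Ch. VII §10 (abelian `L`-series). [NeukirchANT1999]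
-/

noncomputable section

open Finset
open scoped Classical

namespace Literature.NumberTheory.LFunctions.CharacterGroup

variable {G : Type*} [CommGroup G] [Finite G] [Fintype (G →* ℂˣ)]

/-- **`#{χ : G →* ℂˣ | χ trivial on B} = [G : B]`** (duality for finite abelian groups, Mathlib
`CommGroup.card_subgroupOrderIsoSubgroupMonoidHom`). [cite: Washington1997, Lemma 3.1 ff. / proof of Thm. 4.3] -/
theorem card_filter_monoidHom_trivialOn (B : Subgroup G) :
    #{χ : G →* ℂˣ | ∀ b ∈ B, χ b = 1} = B.index := by
  classical
  set X := OrderDual.ofDual (CommGroup.subgroupOrderIsoSubgroupMonoidHom G ℂ B) with hX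
  have hmem : ∀ χ : G →* ℂˣ, χ ∈ X ↔ ∀ b ∈ B, χ b = 1 := fun χ =>
    CommGroup.mem_subgroupOrderIsoSubgroupMonoidHom_iff (G := G) (M := ℂ) B χ
  have hcard : Nat.card X = Nat.card (G ⧸ B) := CommGroup.card_subgroupOrderIsoSubgroupMonoidHom ℂ B
  rw [Subgroup.index_eq_card, ← hcard,
    Nat.card_congr (Equiv.subtypeEquivRight hmem : X ≃ {χ : G →* ℂˣ // ∀ b ∈ B, χ b = 1}),
    Nat.card_eq_fintype_card, Fintype.card_subtype]

/-- **Character product lemma for a subgroup of a finite abelian group.** For `B ≤ G`, `u ∈ G` whose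
class in `G/B` has order `f`, and `T : ℂ`:
`∏_{χ : G →* ℂˣ, χ|_B = 1} (1 − χ(u) T) = (1 − T^f)^{[G : B⟨u⟩]}` — the characters trivial on `B` are the
dual of `G/B`, `χ ↦ χ(u)` maps them onto the `f`-th roots of unity with fibres of size `[G : B⟨u⟩]`, and
`∏_{ζ^f = 1} (1 − ζ T) = 1 − T^f`. [cite: Washington1997, Thm. 4.3 (proof)] -/
theorem prod_filter_monoidHom_one_sub_apply_mul (B : Subgroup G) (u : G) (T : ℂ) :
    ∏ χ ∈ ({χ | ∀ b ∈ B, χ b = 1} : Finset (G →* ℂˣ)), (1 - (χ u : ℂ) * T) =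
      (1 - T ^ orderOf (QuotientGroup.mk u : G ⧸ B)) ^ (B ⊔ Subgroup.zpowers u).index := by
  classical
  set f := orderOf (QuotientGroup.mk u : G ⧸ B) with hf
  have hf0 : 0 < f := by rw [hf]; exact orderOf_pos (QuotientGroup.mk u : G ⧸ B)
  set c := (B ⊔ Subgroup.zpowers u).index with hc
  set Y : Finset (G →* ℂˣ) := {χ | ∀ b ∈ B, χ b = 1} with hY
  have hcf : f * c = #Y := by
    rw [hY, card_filter_monoidHom_trivialOn, AbelianDedekindZeta.orderOf_mk_mul_index_sup']
  -- the fibre over `1`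
  have hker : #{χ ∈ Y | χ u = 1} = c := by
    rw [hc, ← card_filter_monoidHom_trivialOn (B ⊔ Subgroup.zpowers u), hY, Finset.filter_filter]
    congr 1
    ext χ
    simp only [mem_filter, mem_univ, true_and]
    constructor
    · rintro ⟨hB, hu⟩ b hb
      have hle : B ⊔ Subgroup.zpowers u ≤ χ.ker := by
        rw [sup_le_iff, Subgroup.zpowers_le, MonoidHom.mem_ker]
        exact ⟨fun x hx => by rw [MonoidHom.mem_ker]; exact hB x hx, hu⟩
      have := hle hb
      rwa [MonoidHom.mem_ker] at this
    · intro h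
      exact ⟨fun b hb => h b (Subgroup.mem_sup_left hb),
        h u (Subgroup.mem_sup_right (Subgroup.mem_zpowers u))⟩
  -- evaluation at `u`
  set φ : (G →* ℂˣ) →* ℂˣ :=
    { toFun := fun χ ↦ χ u, map_one' := rfl, map_mul' := fun _ _ ↦ rfl } with hφ
  have hφapp : ∀ χ : G →* ℂˣ, φ χ = χ u := fun χ ↦ rfl
  -- all fibres have `c` elements
  have hfib : ∀ x ∈ Y.image φ, #{χ ∈ Y | φ χ = x} = c := by
    intro x hx
    obtain ⟨χ₁, hχ₁, rfl⟩ := Finset.mem_image.mp hx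
    rw [← hker]
    refine Finset.card_bij (fun χ _ => χ₁⁻¹ * χ) (fun χ hχ => ?_) (fun χ hχ χ' hχ' h => ?_)
      (fun χ hχ => ?_)
    · rw [mem_filter] at hχ ⊢
      refine ⟨?_, ?_⟩
      · rw [hY, mem_filter] at hχ hχ₁ ⊢
        refine ⟨mem_univ _, fun b hb => ?_⟩
        rw [MonoidHom.mul_apply, MonoidHom.inv_apply, hχ₁.2 b hb, hχ.1.2 b hb, inv_one, mul_one]
      · have h2 : φ χ = φ χ₁ := hχ.2
        rw [hφapp, hφapp] at h2
        rw [MonoidHom.mul_apply, MonoidHom.inv_apply, h2, inv_mul_cancel]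
    · exact mul_left_cancel h
    · rw [mem_filter] at hχ
      refine ⟨χ₁ * χ, ?_, inv_mul_cancel_left χ₁ χ⟩
      rw [mem_filter]
      refine ⟨?_, ?_⟩
      · rw [hY, mem_filter] at hχ hχ₁ ⊢
        refine ⟨mem_univ _, fun b hb => ?_⟩
        rw [MonoidHom.mul_apply, hχ₁.2 b hb, hχ.1.2 b hb, mul_one]
      · have h3 : φ χ = 1 := by rw [hφapp]; exact hχ.2
        rw [map_mul, h3, mul_one]
  -- rewrite the product along `φ`
  have h1 : ∏ χ ∈ Y, (1 - (χ u : ℂ) * T) = ∏ χ ∈ Y, (fun x : ℂˣ ↦ 1 - (x : ℂ) * T) (φ χ) := by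
    refine Finset.prod_congr rfl fun χ _ ↦ ?_
    simp only [hφapp]
  rw [h1, Finset.prod_comp (f := fun x : ℂˣ ↦ 1 - (x : ℂ) * T) (g := φ)]
  rw [Finset.prod_congr rfl fun x hx ↦ by rw [hfib x hx], Finset.prod_pow]
  congr 1
  -- the image of `φ` on `Y` is the set of `f`-th roots of unity
  have hcpos : 0 < c := Nat.pos_of_ne_zero Subgroup.index_ne_zero_of_finite
  have hcard_img : (Y.image φ).card = f := by
    have htot : #Y = (Y.image φ).card * c := by
      rw [Finset.card_eq_sum_card_image φ Y, Finset.sum_congr rfl hfib, sum_const, smul_eq_mul]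
    have : (Y.image φ).card * c = f * c := by rw [← htot, hcf]
    exact Nat.eq_of_mul_eq_mul_right hcpos this
  have huf : u ^ f ∈ B := (AbelianSplitting.pow_mem_iff_orderOf_mk_dvd B u f).mpr dvd_rfl
  have hsub : (Y.image φ).image (Units.val : ℂˣ → ℂ) ⊆ Polynomial.nthRootsFinset f (1 : ℂ) := by
    intro z hz
    obtain ⟨x, hx, rfl⟩ := Finset.mem_image.mp hz
    obtain ⟨χ, hχ, rfl⟩ := Finset.mem_image.mp hx
    rw [hY, mem_filter] at hχ
    rw [Polynomial.mem_nthRootsFinset hf0, hφapp, ← Units.val_pow_eq_pow_val, ← map_pow, hχ.2 _ huf,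
      Units.val_one]
  have heq : (Y.image φ).image (Units.val : ℂˣ → ℂ) = Polynomial.nthRootsFinset f (1 : ℂ) := by
    refine Finset.eq_of_subset_of_card_le hsub ?_
    rw [(Complex.isPrimitiveRoot_exp f hf0.ne').card_nthRootsFinset,
      Finset.card_image_of_injective _ Units.val_injective, hcard_img]
  rw [← Finset.prod_image (s := Y.image φ) (g := (Units.val : ℂˣ → ℂ))
    (f := fun z : ℂ ↦ 1 - z * T) Units.val_injective.injOn, heq,
    ← (Complex.isPrimitiveRoot_exp f hf0.ne').pow_sub_pow_eq_prod_sub_mul 1 T hf0, one_pow]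

/-- **`∏_{χ ∈ Ĝ} (1 − χ(u) T) = (1 − T^{ord u})^{[G : ⟨u⟩]}`** for a finite abelian group `G`, `u ∈ G`,
`T : ℂ` (the Euler factor at an unramified prime with Frobenius `u` of the product of the abelian
`L`-series over all characters of `G`). [cite: Washington1997, Thm. 4.3 (proof)] -/
theorem prod_monoidHom_one_sub_apply_mul (u : G) (T : ℂ) :
    ∏ χ : G →* ℂˣ, (1 - (χ u : ℂ) * T) = (1 - T ^ orderOf u) ^ (Subgroup.zpowers u).index := by
  classical
  have h := prod_filter_monoidHom_one_sub_apply_mul (⊥ : Subgroup G) u T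
  have hfilter : ({χ | ∀ b ∈ (⊥ : Subgroup G), χ b = 1} : Finset (G →* ℂˣ)) = Finset.univ := by
    ext χ
    simp only [mem_filter, mem_univ, true_and, iff_true]
    intro b hb
    rw [Subgroup.mem_bot] at hb
    rw [hb, map_one]
  have hord : orderOf (QuotientGroup.mk u : G ⧸ (⊥ : Subgroup G)) = orderOf u := by
    rw [← QuotientGroup.mk'_apply]
    exact orderOf_injective (QuotientGroup.mk' (⊥ : Subgroup G))
      (by rw [← MonoidHom.ker_eq_bot_iff, QuotientGroup.ker_mk']) u
  rw [hfilter, hord, bot_sup_eq] at h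
  exact h

end Literature.NumberTheory.LFunctions.CharacterGroup
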